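import Mathlib
import Summits.Ventures.HodgeRepro.Tier4.Target
import Summits.Ventures.HodgeRepro.Tier4.Line3.Defs
import Summits.Ventures.HodgeRepro.Tier4.Line3.LocaliserS
import Summits.Ventures.HodgeRepro.Tier4.Line3.Witness.ThetaDataWitnessCf
import Summits.Ventures.HodgeRepro.Tier4.Line3.GrowthInvOfMajorant

/-!
# Tier4/Line3/ContentIdeal — the CONTENT of a vector of `V(E′)`, its norm, and how `Γ` and the `𝔭`-adic
representatives move it

Blind re-derivation cell `pub-hodge-repro`, Tier 4 «PROVE THE STEP» (README §9–§10), LINE L3, lemma L3.5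
`term_dominated`; seat t4-L2-p3 (gen 3); the typed object behind the content witness of `CoefMajorantWitness`
(p676981): the free factor `κ` of `hasCoefMajorant_of_content` becomes a power of the NORM OF THE CONTENT IDEAL.

* `content x = (x₀, x₁, x₂) ⊆ E′` — the fractional `𝒪_{E′}`-ideal generated by the coordinates
  (`FractionalIdeal.spanFinset`); `contentNorm x = N(content x) ∈ ℚ ⊆ ℝ` (`FractionalIdeal.absNorm`).
* `absNorm_le_of_le`: in a Dedekind domain a SMALLER non-zero fractional ideal has a LARGER norm
  (`I ≤ J → N(J) ≤ N(I)`), so `contentNorm x ≤ |N_{E′/ℚ}(x_i)|` for every non-zero coordinate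
  (`contentNorm_le_abs_norm_coord`) — the archimedean control of the content.
* `content_mulVec_eq_of_integral`: an integral matrix with an integral inverse preserves the content; in particular
  every `γ ∈ Γ ⊆ GL₃(𝒪)` does (`content_mulVec_eq_of_mem_Γ`, `contentNorm_mulVec_eq_of_mem_Γ`) — the exact
  `Γ`-invariance of the content norm.
* `RepDenom ℓ`: every coset representative `r` occurring in the depth-`N` localiser has an inverse with entries in
  `((𝔭 𝔭̄)^N)⁻¹` — the `𝔭`-adic depth of the representatives, a clause on the LOCALISER alone (L3.3); with it
  `contentNorm (r x) ≤ N(𝔭 𝔭̄)^N · contentNorm x` (`contentNorm_mulVec_le_of_repDenom`): `x = r⁻¹ (r x)` puts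
  `content x ⊆ ((𝔭𝔭̄)^N)⁻¹ · content (r x)`, and the norm is multiplicative.

No printed input is consumed; nothing here asserts anything about the truth of (P); HC_CM is NOT proved by anyone
in this repository.
-/

set_option autoImplicit false

noncomputable section

namespace Summit.Ventures.HodgeRepro.Tier4.Line3

open Summit.Ventures.HodgeRepro.Tier4
open Matrix NumberField
open scoped nonZeroDivisors

/-! ### 1. The norm of fractional ideals of a Dedekind domain is antitone -/

section AbsNormAntitone

variable {R : Type*} [CommRing R] [IsDedekindDomain R] [Module.Free ℤ R] [Module.Finite ℤ R]
variable {K : Type*} [Field K] [Algebra R K] [IsFractionRing R K]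

/-- A non-zero integral fractional ideal has norm `≥ 1`. -/
theorem one_le_absNorm_of_le_one {I : FractionalIdeal R⁰ K} (hI : I ≠ 0) (h : I ≤ 1) :
    1 ≤ FractionalIdeal.absNorm I := by
  obtain ⟨I₀, rfl⟩ := FractionalIdeal.le_one_iff_exists_coeIdeal.mp h
  rw [FractionalIdeal.coeIdeal_absNorm]
  have h0 : I₀ ≠ ⊥ := fun h0 => hI (by rw [h0, FractionalIdeal.coeIdeal_bot])
  have : Ideal.absNorm I₀ ≠ 0 := fun h1 => h0 (Ideal.absNorm_eq_zero_iff.mp h1)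
  exact_mod_cast Nat.one_le_iff_ne_zero.mpr this

/-- **The norm is antitone**: `I ≤ J` with `I ≠ 0` gives `N(J) ≤ N(I)` (`I = J · (J⁻¹ I)` with `J⁻¹ I` integral and
non-zero). -/
theorem absNorm_le_of_le {I J : FractionalIdeal R⁰ K} (hI : I ≠ 0) (h : I ≤ J) :
    FractionalIdeal.absNorm J ≤ FractionalIdeal.absNorm I := by
  have hJ : J ≠ 0 := fun hJ => hI (le_antisymm (hJ ▸ h) bot_le)
  have hK : J⁻¹ * I ≤ 1 := by
    calc J⁻¹ * I ≤ J⁻¹ * J := mul_le_mul_right h _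
      _ = 1 := inv_mul_cancel₀ hJ
  have hK0 : J⁻¹ * I ≠ 0 := mul_ne_zero (inv_ne_zero hJ) hI
  have hsplit : I = J * (J⁻¹ * I) := by
    rw [← mul_assoc, mul_inv_cancel₀ hJ, one_mul]
  have h1 := one_le_absNorm_of_le_one hK0 hK
  have hJn : 0 ≤ FractionalIdeal.absNorm J := FractionalIdeal.absNorm_nonneg J
  calc FractionalIdeal.absNorm J = FractionalIdeal.absNorm J * 1 := (mul_one _).symm
    _ ≤ FractionalIdeal.absNorm J * FractionalIdeal.absNorm (J⁻¹ * I) :=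
        mul_le_mul_of_nonneg_left h1 hJn
    _ = FractionalIdeal.absNorm I := by rw [← map_mul, ← hsplit]

end AbsNormAntitone

namespace T4Data

variable (X : T4Data)

/-! ### 2. The content ideal and its norm -/

/-- **The content** of `x ∈ V(E′)`: the fractional ideal `(x₀, x₁, x₂)` generated by the coordinates. -/
def content (x : Fin 3 → X.E) : FractionalIdeal (RingOfIntegers X.E)⁰ X.E :=
  FractionalIdeal.spanFinset (RingOfIntegers X.E) Finset.univ x

/-- **The norm of the content**, as a real number. -/
def contentNorm (x : Fin 3 → X.E) : ℝ := (FractionalIdeal.absNorm (X.content x) : ℝ)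

/-- `0 ≤ contentNorm`. -/
theorem contentNorm_nonneg (x : Fin 3 → X.E) : 0 ≤ X.contentNorm x := by
  unfold contentNorm
  exact_mod_cast FractionalIdeal.absNorm_nonneg _

/-- Every coordinate lies in the content. -/
theorem coord_mem_content (x : Fin 3 → X.E) (i : Fin 3) : x i ∈ X.content x := by
  rw [← FractionalIdeal.mem_coe, content, FractionalIdeal.spanFinset_coe]
  exact Submodule.subset_span ⟨i, Finset.mem_univ i, rfl⟩

/-- The content is the smallest fractional ideal containing the coordinates. -/
theorem content_le_of_forall_mem {x : Fin 3 → X.E} {J : FractionalIdeal (RingOfIntegers X.E)⁰ X.E}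
    (h : ∀ i, x i ∈ J) : X.content x ≤ J := by
  rw [← FractionalIdeal.coe_le_coe, content, FractionalIdeal.spanFinset_coe, Submodule.span_le]
  rintro _ ⟨i, -, rfl⟩
  exact FractionalIdeal.mem_coe.mpr (h i)

/-- The content of `x ≠ 0` is non-zero. -/
theorem content_ne_zero {x : Fin 3 → X.E} (hx : x ≠ 0) : X.content x ≠ 0 := by
  rw [content, Ne, FractionalIdeal.spanFinset_eq_zero]
  intro h
  exact hx (funext fun i => h i (Finset.mem_univ i))

/-- Sums of members are members (fractional ideals are `𝒪`-submodules). -/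
theorem sum_mem_fractionalIdeal {ι : Type} [Fintype ι] {J : FractionalIdeal (RingOfIntegers X.E)⁰ X.E}
    {f : ι → X.E} (h : ∀ i, f i ∈ J) : ∑ i, f i ∈ J :=
  FractionalIdeal.mem_coe.mp (Submodule.sum_mem _ fun i _ => FractionalIdeal.mem_coe.mpr (h i))

/-- An integral multiple of a member is a member. -/
theorem integral_mul_mem_fractionalIdeal {J : FractionalIdeal (RingOfIntegers X.E)⁰ X.E} {a v : X.E}
    (ha : IsIntegral ℤ a) (hv : v ∈ J) : a * v ∈ J := by
  have : a * v = (⟨a, ha⟩ : RingOfIntegers X.E) • v := by rw [Algebra.smul_def]; rfl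
  rw [this]
  exact FractionalIdeal.mem_coe.mp (Submodule.smul_mem _ _ (FractionalIdeal.mem_coe.mpr hv))

/-! ### 3. The archimedean control: the content norm is at most the norm of any non-zero coordinate -/

/-- `contentNorm x ≤ |N_{E′/ℚ}(x_i)|` for every coordinate `x_i ≠ 0` (the principal ideal `(x_i)` lies in the
content and the norm is antitone). -/
theorem contentNorm_le_abs_norm_coord (x : Fin 3 → X.E) (i : Fin 3) (hi : x i ≠ 0) :
    X.contentNorm x ≤ |Algebra.norm ℚ (x i)| := by
  have hle : FractionalIdeal.spanSingleton (RingOfIntegers X.E)⁰ (x i) ≤ X.content x :=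
    FractionalIdeal.spanSingleton_le_iff_mem.mpr (X.coord_mem_content x i)
  have hne : FractionalIdeal.spanSingleton (RingOfIntegers X.E)⁰ (x i) ≠ 0 :=
    (FractionalIdeal.spanSingleton_ne_zero_iff).mpr hi
  have := absNorm_le_of_le hne hle
  rw [FractionalIdeal.absNorm_span_singleton] at this
  unfold contentNorm
  exact_mod_cast this

/-! ### 4. `Γ`-invariance of the content -/

/-- An integral matrix does not enlarge the content. -/
theorem content_mulVec_le_of_integral {γ : Matrix (Fin 3) (Fin 3) X.E} (hγ : IsIntegralMatrix γ)
    (x : Fin 3 → X.E) : X.content (γ *ᵥ x) ≤ X.content x := by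
  refine X.content_le_of_forall_mem fun i => ?_
  simp only [Matrix.mulVec, dotProduct]
  exact X.sum_mem_fractionalIdeal fun j => X.integral_mul_mem_fractionalIdeal (hγ i j) (X.coord_mem_content x j)

/-- An integral matrix with an integral left inverse preserves the content. -/
theorem content_mulVec_eq_of_integral {γ δ : Matrix (Fin 3) (Fin 3) X.E} (hγ : IsIntegralMatrix γ)
    (hδ : IsIntegralMatrix δ) (hδγ : δ * γ = 1) (x : Fin 3 → X.E) : X.content (γ *ᵥ x) = X.content x := by
  refine le_antisymm (X.content_mulVec_le_of_integral hγ x) ?_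
  have := X.content_mulVec_le_of_integral hδ (γ *ᵥ x)
  rwa [Matrix.mulVec_mulVec, hδγ, Matrix.one_mulVec] at this

/-- **`Γ` preserves the content** (`Γ ⊆ GL₃(𝒪)`). -/
theorem content_mulVec_eq_of_mem_Γ {γ : Matrix (Fin 3) (Fin 3) X.E} (hγ : γ ∈ X.Γ) (x : Fin 3 → X.E) :
    X.content (γ *ᵥ x) = X.content x := by
  obtain ⟨δ, hδ, -, hδγ⟩ := X.exists_inv_mem_Γ hγ
  exact X.content_mulVec_eq_of_integral (X.integral_of_mem_Γ hγ) (X.integral_of_mem_Γ hδ) hδγ x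

/-- **`Γ` preserves the content norm.** -/
theorem contentNorm_mulVec_eq_of_mem_Γ {γ : Matrix (Fin 3) (Fin 3) X.E} (hγ : γ ∈ X.Γ) (x : Fin 3 → X.E) :
    X.contentNorm (γ *ᵥ x) = X.contentNorm x := by
  unfold contentNorm
  rw [X.content_mulVec_eq_of_mem_Γ hγ x]

/-! ### 5. The `𝔭`-adic depth of the localiser's representatives and the growth of the content -/

/-- The depth-`N` ideal `(𝔭 𝔭̄)^N` of the split prime, as a fractional ideal. -/
def depthIdeal (p : IsDedekindDomain.HeightOneSpectrum (RingOfIntegers X.E)) (N : ℕ) :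
    FractionalIdeal (RingOfIntegers X.E)⁰ X.E :=
  ((p.asIdeal * X.conjIdeal p.asIdeal) ^ N : Ideal (RingOfIntegers X.E))

/-- The norm of the depth ideal is `N(𝔭 𝔭̄)^N`. -/
theorem absNorm_depthIdeal (p : IsDedekindDomain.HeightOneSpectrum (RingOfIntegers X.E)) (N : ℕ) :
    FractionalIdeal.absNorm (X.depthIdeal p N) =
      ((Ideal.absNorm (p.asIdeal * X.conjIdeal p.asIdeal) : ℚ)) ^ N := by
  unfold depthIdeal
  rw [FractionalIdeal.coeIdeal_absNorm, map_pow]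
  push_cast
  rfl

/-- The depth ideal is non-zero (`𝔭` is a non-zero prime; its conjugate is the image under a ring automorphism). -/
theorem depthIdeal_ne_zero (p : IsDedekindDomain.HeightOneSpectrum (RingOfIntegers X.E)) (N : ℕ) :
    X.depthIdeal p N ≠ 0 := by
  unfold depthIdeal
  rw [Ne, FractionalIdeal.coeIdeal_eq_zero]
  refine pow_ne_zero N (mul_ne_zero p.ne_bot ?_)
  intro h
  apply p.ne_bot
  -- `conjIdeal 𝔭 = map c 𝔭 = ⊥` forces `𝔭 = ⊥`: `c` is a ring equivalence, so `map` is injective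
  unfold conjIdeal at h
  have hinj : Function.Injective (RingOfIntegers.mapRingEquiv X.c).toRingHom := (RingOfIntegers.mapRingEquiv X.c).injective
  exact Ideal.map_eq_bot_iff_of_injective hinj |>.mp h

/-- `1 ≤ N(𝔭 𝔭̄)`. -/
theorem one_le_absNorm_depthPrime (p : IsDedekindDomain.HeightOneSpectrum (RingOfIntegers X.E)) :
    1 ≤ (Ideal.absNorm (p.asIdeal * X.conjIdeal p.asIdeal) : ℝ) := by
  have h := X.depthIdeal_ne_zero p 1
  unfold depthIdeal at h
  rw [pow_one, Ne, FractionalIdeal.coeIdeal_eq_zero] at h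
  have : Ideal.absNorm (p.asIdeal * X.conjIdeal p.asIdeal) ≠ 0 := fun h0 => h (Ideal.absNorm_eq_zero_iff.mp h0)
  exact_mod_cast Nat.one_le_iff_ne_zero.mpr this

/-- **THE DEPTH CLAUSE OF A LOCALISER** (a clause on the localiser alone, L3.3): every coset representative `r`
occurring in the depth-`N` combination has an inverse with entries in `((𝔭 𝔭̄)^N)⁻¹` — the representatives have
denominators at `𝔭 𝔭̄` only, of depth at most `N`. -/
def RepDenom (D : X.ThetaData) {p : IsDedekindDomain.HeightOneSpectrum (RingOfIntegers X.E)}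
    {L₀ : Submodule (RingOfIntegers X.E) (Fin 3 → X.E)} {xm : X.Tuple} (ℓ : X.LocS D p L₀ xm) : Prop :=
  ∀ N r, X.IsRepOf (ℓ.loc N) r → ∃ r' : Matrix (Fin 3) (Fin 3) X.E, r' * r = 1 ∧
    ∀ i j, r' i j ∈ (X.depthIdeal p N)⁻¹

/-- **The content norm grows at most by `N(𝔭 𝔭̄)^N` under a representative of depth `N`**: with `r' r = 1` and
`r'` with entries in `((𝔭𝔭̄)^N)⁻¹`, `content x = content (r' (r x)) ⊆ ((𝔭𝔭̄)^N)⁻¹ · content (r x)`, so by the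
antitone multiplicative norm `N(content (r x)) ≤ N((𝔭𝔭̄)^N) · N(content x)`. -/
theorem contentNorm_mulVec_le_of_inv_entries
    (p : IsDedekindDomain.HeightOneSpectrum (RingOfIntegers X.E)) (N : ℕ)
    {r r' : Matrix (Fin 3) (Fin 3) X.E} (hr' : r' * r = 1) (hent : ∀ i j, r' i j ∈ (X.depthIdeal p N)⁻¹)
    (x : Fin 3 → X.E) :
    X.contentNorm (r *ᵥ x) ≤ (Ideal.absNorm (p.asIdeal * X.conjIdeal p.asIdeal) : ℝ) ^ N * X.contentNorm x := by
  by_cases hx : x = 0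
  · subst hx
    rw [Matrix.mulVec_zero]
    have h0 : X.contentNorm 0 = 0 := by
      have hc : X.content 0 = 0 := FractionalIdeal.spanFinset_eq_zero.mpr (fun _ _ => rfl)
      unfold contentNorm
      rw [hc, map_zero, Rat.cast_zero]
    rw [h0, mul_zero]
  · -- `content x ≤ (depthIdeal)⁻¹ * content (r x)`
    have hsub : X.content x ≤ (X.depthIdeal p N)⁻¹ * X.content (r *ᵥ x) := by
      refine X.content_le_of_forall_mem fun i => ?_
      have hxi : x i = (r' *ᵥ (r *ᵥ x)) i := by
        rw [Matrix.mulVec_mulVec, hr', Matrix.one_mulVec]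
      rw [hxi]
      simp only [Matrix.mulVec, dotProduct]
      exact X.sum_mem_fractionalIdeal fun j =>
        FractionalIdeal.mul_mem_mul (hent i j) (X.coord_mem_content (r *ᵥ x) j)
    have hne : X.content x ≠ 0 := X.content_ne_zero hx
    have h1 := absNorm_le_of_le hne hsub
    rw [map_mul, map_inv₀, X.absNorm_depthIdeal] at h1
    -- clear the inverse
    have hq : (0 : ℚ) < (Ideal.absNorm (p.asIdeal * X.conjIdeal p.asIdeal) : ℚ) ^ N := by
      have := X.one_le_absNorm_depthPrime p
      have h1' : (1 : ℚ) ≤ (Ideal.absNorm (p.asIdeal * X.conjIdeal p.asIdeal) : ℚ) := by exact_mod_cast this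
      positivity
    unfold contentNorm
    have h2 : FractionalIdeal.absNorm (X.content (r *ᵥ x)) ≤
        (Ideal.absNorm (p.asIdeal * X.conjIdeal p.asIdeal) : ℚ) ^ N * FractionalIdeal.absNorm (X.content x) := by
      rw [inv_mul_le_iff₀ hq] at h1
      exact h1
    exact_mod_cast h2

/-- **The content norm under the localiser's representatives**, from the depth clause. -/
theorem contentNorm_mulVec_le_of_repDenom (D : X.ThetaData)
    {p : IsDedekindDomain.HeightOneSpectrum (RingOfIntegers X.E)}
    {L₀ : Submodule (RingOfIntegers X.E) (Fin 3 → X.E)} {xm : X.Tuple} (ℓ : X.LocS D p L₀ xm)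
    (hrep : X.RepDenom D ℓ) (N : ℕ) (r : Matrix (Fin 3) (Fin 3) X.E) (hr : X.IsRepOf (ℓ.loc N) r)
    (x : Fin 3 → X.E) :
    X.contentNorm (r *ᵥ x) ≤ (Ideal.absNorm (p.asIdeal * X.conjIdeal p.asIdeal) : ℝ) ^ N * X.contentNorm x := by
  obtain ⟨r', hr', hent⟩ := hrep N r hr
  exact X.contentNorm_mulVec_le_of_inv_entries p N hr' hent x

end T4Data

end Summit.Ventures.HodgeRepro.Tier4.Line3

end
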